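import Summits.CriticalPhenomena.PercolationContinuityZ3.Theorems.FK.RadiusDecayRate
import HarnessLib

/-!
# FK-continuity cell, FO-10a: the inverse correlation length of `φ^b_{p,q}` in a general direction `u` is comparable
# to a norm of `u` — `‖u‖_∞ ψ ≤ ψ(u) ≤ ‖u‖₁ ψ` with `ψ` the axis / radius rate (Grimmett 2006, Thm. (5.44) context:
# `φ(0 ↔ x) ≤ e^{-‖x‖_∞ ψ}` for every site `x`, the pointwise form of (5.46))

Registered R120 (cell INBOX l.7682, 2026-08-25); registry row FO-10a-g343m; label CRM-B (coordinator fk-4 g231).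
Cell `fk-continuity` (bschramm), row FO-10a; support file for the FK-continuity transplant
(`--supports stmt-CriticalPhenomena-4575`); builds on p205010 (kernel theorem, internal audit signed; external expert
review pending). Companion of `ConnectivityDecayRate.lean` (the rate `ψ(u) = lim -n⁻¹ log φ(0 ↔ nu)` along a lattice
vector `u`) and `RadiusDecayRate.lean` (the axis rate `ψ = ψ(e_k)` is the same for every axis and equals the radius
rate). Pure proofs; no definitions, no named facts, no sorries. UNCONDITIONAL; decides nothing about the value of `ψ`.

For a translation- and lattice-symmetry-invariant, positively associated probability measure `μ` whose axis two-point
function obeys `μ(0 ↔ m e_k) ≤ e^{-mψ}` (the conclusion of Thm. (5.44)):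
* the reflection trick of `RadiusDecayRate.lean` gives `μ(0 ↔ x) ≤ e^{-nψ}` for every `x ∈ ∂Λ_n`, i.e.
  **`μ(0 ↔ x) ≤ e^{-‖x‖_∞ ψ}` for EVERY site `x`** (`real_openConn_le_exp_supNorm`), whence along any direction
  `u` the rate satisfies `ψ(u) ≥ ‖u‖_∞ ψ`;
* supermultiplicativity along the coordinate path `0 → n u₁e₁ → n u₁e₁ + n u₂e₂ → … → nu` and axis symmetry give
  `μ(0 ↔ nu) ≥ ∏ᵢ μ(0 ↔ n|uᵢ| e_k)`, whence `ψ(u) ≤ ‖u‖₁ ψ`.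
In particular `ψ(u) = 0 ↔ ψ = 0` and `ψ(u) > 0 ↔ ψ > 0` for every `u ≠ 0`.

## Contents (namespace `Summit.CriticalPhenomena.PercolationContinuityZ3.Theorems.FK`)

* §1 lattice: `mem_innerBoundary_box_sup_natAbs` (`x ∈ ∂ⁱⁿΛ_{‖x‖_∞}`, `d ≥ 1`), `sup_natAbs_nsmul`
  (`‖nu‖_∞ = n‖u‖_∞`), `univ_sum_zsmul_single` (`u = Σᵢ uᵢ • eᵢ`);
* §2 general `μ`: **`real_openConn_le_exp_supNorm`** (`μ(0 ↔ x) ≤ e^{-‖x‖_∞ψ}`), `prod_real_openConn_le_real_openConn_sum`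
  (supermultiplicativity over a finite sum of vectors), `real_openConn_zsmul_single_eq` (`μ(0 ↔ a eᵢ) = μ(0 ↔ |a| e_k)`),
  **`supNorm_mul_le_of_tendsto`** (`‖u‖_∞ ψ ≤ ψ(u)`) and **`le_l1Norm_mul_of_tendsto`** (`ψ(u) ≤ ‖u‖₁ ψ`);
* §3 `φ^b_{p,q}` / `rcLimit d b p q` (`0 < p ≤ 1`, `q ≥ 1`, `d ≥ 1`): **`exists_decayRate_rcLimit_norm_bounds`** — for
  every `u` there are `ψ_u, ψ ≥ 0`, the limits of `-n⁻¹ log φ^b(0 ↔ nu)` and `-n⁻¹ log φ^b(0 ↔ ∂Λ_n)`, with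
  `‖u‖_∞ ψ ≤ ψ_u ≤ ‖u‖₁ ψ`.

## References

* G. Grimmett, *The Random-Cluster Model*, Springer 2006, §5.4 Thm. (5.44), Cor. (5.45), eq. (5.46). [Grimmett2006]
* G. Grimmett, *Percolation*, 2nd ed., Springer 1999, §6.3 Thm. (6.44) and the remarks after it (direction dependence
  of the connectivity decay). [GrimmettPercolation1999]
-/

noncomputable section

open MeasureTheory Set Filter
open scoped Topology

namespace Summit.CriticalPhenomena.PercolationContinuityZ3.Theorems.FK

open Literature.Probability.Percolation Literature.Probability.LatticeModels
open Literature.Barriers.CriticalPhenomena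

/-! ### §1 Lattice geometry: the sup-norm shell and the coordinate decomposition -/

section Lattice

variable {d : ℕ}

/-- Every site `x` of `ℤ^d` (`d ≥ 1`) lies on the inner vertex boundary of the box `Λ_{‖x‖_∞}`,
`‖x‖_∞ = maxᵢ |xᵢ|`. [folklore] -/
theorem mem_innerBoundary_box_sup_natAbs (hd : 0 < d) (x : Site d) :
    x ∈ innerBoundary (zdGraph d) (box d (Finset.univ.sup fun i => (x i).natAbs)) := by
  classical
  set n := Finset.univ.sup fun i => (x i).natAbs with hn
  haveI : Nonempty (Fin d) := ⟨⟨0, hd⟩⟩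
  obtain ⟨i, -, hi⟩ := Finset.exists_mem_eq_sup (Finset.univ : Finset (Fin d)) Finset.univ_nonempty
    fun i => (x i).natAbs
  rw [mem_innerBoundary_iff]
  refine ⟨?_, ?_⟩
  · rw [mem_box]
    intro j
    have hj : (x j).natAbs ≤ n := Finset.le_sup (f := fun i => (x i).natAbs) (Finset.mem_univ j)
    omega
  · -- the neighbour `x ± e_i` in the direction of the maximal coordinate leaves the box
    rcases le_or_gt 0 (x i) with h0 | h0
    · refine ⟨x + Pi.single i 1, ?_, (zdGraph_adj_iff _ _).2 ⟨i, Or.inl rfl⟩⟩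
      rw [mem_box, not_forall]
      refine ⟨i, fun h => ?_⟩
      have h2 := h.2
      simp only [Pi.add_apply, Pi.single_eq_same] at h2
      have : (x i).natAbs = n := by rw [hn]; exact hi.symm
      omega
    · refine ⟨x - Pi.single i 1, ?_, (zdGraph_adj_iff _ _).2 ⟨i, Or.inr (by simp)⟩⟩
      rw [mem_box, not_forall]
      refine ⟨i, fun h => ?_⟩
      have h1 := h.1
      simp only [Pi.sub_apply, Pi.single_eq_same] at h1
      have : (x i).natAbs = n := by rw [hn]; exact hi.symm
      omega

/-- `‖n u‖_∞ = n ‖u‖_∞` for the sup of the absolute coordinates. [folklore] -/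
theorem sup_natAbs_nsmul (u : Site d) (n : ℕ) :
    (Finset.univ.sup fun i => ((n • u) i).natAbs) = n * Finset.univ.sup fun i => (u i).natAbs := by
  classical
  simp only [Pi.smul_apply, nsmul_eq_mul, Int.natAbs_mul, Int.natAbs_natCast]
  exact (Finset.apply_sup_eq_sup_comp (s := Finset.univ) (f := fun i => (u i).natAbs) (n * ·)
    (fun x y => (max_mul_mul_left n x y).symm) (mul_zero n)).symm

/-- `u = Σᵢ uᵢ • eᵢ` with integer coefficients. [folklore] -/
theorem univ_sum_zsmul_single (u : Site d) : ∑ i, (u i) • (Pi.single i (1 : ℤ) : Site d) = u := by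
  have h : ∀ i, (u i) • (Pi.single i (1 : ℤ) : Site d) = Pi.single i (u i) := by
    intro i; ext j
    by_cases hj : j = i
    · subst hj; simp
    · simp [Pi.single_eq_of_ne hj]
  simp_rw [h]
  exact Finset.univ_sum_single u

end Lattice

/-! ### §2 Invariant positively associated measures: pointwise decay and the norm bounds for `ψ(u)` -/

section Invariant

variable {d : ℕ} {μ : Measure (BondConfig (Site d))}

/-- **`μ(0 ↔ x) ≤ e^{-‖x‖_∞ ψ}` for every site `x`** (`d ≥ 1`), for a translation- and symmetry-invariant positively
associated finite measure whose axis two-point function obeys `μ(0 ↔ m e_k) ≤ e^{-mψ}`: the pointwise form of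
(5.46), by the reflection trick (`x` lies on `∂ⁱⁿΛ_{‖x‖_∞}`). [cite: Grimmett2006, Thm. (5.44), eq. (5.46)] -/
theorem real_openConn_le_exp_supNorm [IsFiniteMeasure μ] (hd : 0 < d) (hFKG : IsPositivelyAssociated μ)
    (hT : ∀ v : Site d, MeasurePreserving (BondConfig.relabel (sym2Equiv (Site.shift v))) μ μ)
    (hS : ∀ (π : Equiv.Perm (Fin d)) (ε : Fin d → ℤˣ),
      MeasurePreserving (BondConfig.relabel (sym2Equiv (Site.signedPerm π ε))) μ μ)
    (k : Fin d) {ψ : ℝ}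
    (hψ : ∀ m : ℕ, μ.real (openConn (0 : Site d) (m • (Pi.single k (1 : ℤ) : Site d))) ≤ Real.exp (-(m * ψ)))
    (x : Site d) :
    μ.real (openConn (0 : Site d) x) ≤ Real.exp (-((Finset.univ.sup fun i => (x i).natAbs : ℕ) * ψ)) :=
  real_openConn_le_exp_of_mem_innerBoundary hFKG hT hS k hψ (mem_innerBoundary_box_sup_natAbs hd x)

/-- **Lower norm bound `‖u‖_∞ ψ ≤ ψ(u)`**: if `-n⁻¹ log μ(0 ↔ nu) → ψ_u` then `‖u‖_∞ ψ ≤ ψ_u` (from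
`μ(0 ↔ nu) ≤ e^{-n‖u‖_∞ψ}` and positivity of the two-point function). [cite: Grimmett2006, Thm. (5.44), eq. (5.46)] -/
theorem supNorm_mul_le_of_tendsto [IsFiniteMeasure μ] (hd : 0 < d) (hFKG : IsPositivelyAssociated μ)
    (hT : ∀ v : Site d, MeasurePreserving (BondConfig.relabel (sym2Equiv (Site.shift v))) μ μ)
    (hS : ∀ (π : Equiv.Perm (Fin d)) (ε : Fin d → ℤˣ),
      MeasurePreserving (BondConfig.relabel (sym2Equiv (Site.signedPerm π ε))) μ μ)
    (k : Fin d) {ψ : ℝ}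
    (hψ : ∀ m : ℕ, μ.real (openConn (0 : Site d) (m • (Pi.single k (1 : ℤ) : Site d))) ≤ Real.exp (-(m * ψ)))
    {u : Site d} (hpos : ∀ n : ℕ, 0 < μ.real (openConn (0 : Site d) (n • u))) {ψu : ℝ}
    (hlim : Tendsto (fun n : ℕ => -Real.log (μ.real (openConn (0 : Site d) (n • u))) / n) atTop (𝓝 ψu)) :
    (Finset.univ.sup fun i => (u i).natAbs : ℕ) * ψ ≤ ψu := by
  refine ge_of_tendsto hlim ?_
  filter_upwards [eventually_ge_atTop 1] with n hn
  have hn' : (0 : ℝ) < n := Nat.cast_pos.2 hn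
  have h := real_openConn_le_exp_supNorm hd hFKG hT hS k hψ (n • u)
  rw [sup_natAbs_nsmul, Nat.cast_mul] at h
  have h1 : Real.log (μ.real (openConn (0 : Site d) (n • u))) ≤
      -((n : ℝ) * (Finset.univ.sup fun i => (u i).natAbs : ℕ) * ψ) :=
    (Real.log_le_iff_le_exp (hpos n)).2 h
  rw [le_div_iff₀ hn']
  linarith

/-- All signed axis multiples have the axis two-point function: `μ(0 ↔ a eᵢ) = μ(0 ↔ |a| e_k)`.
[cite: Grimmett2006, Thm. (4.19)(b)] -/
theorem real_openConn_zsmul_single_eq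
    (hS : ∀ (π : Equiv.Perm (Fin d)) (ε : Fin d → ℤˣ),
      MeasurePreserving (BondConfig.relabel (sym2Equiv (Site.signedPerm π ε))) μ μ)
    (k i : Fin d) (a : ℤ) :
    μ.real (openConn (0 : Site d) (a • (Pi.single i (1 : ℤ) : Site d))) =
      μ.real (openConn (0 : Site d) (a.natAbs • (Pi.single k (1 : ℤ) : Site d))) := by
  have h1 : a • (Pi.single i (1 : ℤ) : Site d) = Pi.single i a := by
    ext j
    by_cases hj : j = i
    · subst hj; simp
    · simp [Pi.single_eq_of_ne hj]
  rw [h1, nsmul_single_one]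
  -- `a = s · |a|` for a sign `s`
  obtain ⟨s, hs⟩ : ∃ s : ℤˣ, a = (s : ℤ) * (a.natAbs : ℤ) := by
    rcases Int.natAbs_eq a with h | h
    · exact ⟨1, by simpa using h⟩
    · exact ⟨-1, by rw [Units.val_neg, Units.val_one, neg_mul, one_mul]; exact h⟩
  conv_lhs => rw [hs]
  exact real_openConn_zero_single_eq_of_measurePreserving hS k i s _

/-- **Supermultiplicativity over a finite sum of lattice vectors**: `∏_{i∈s} μ(0 ↔ vᵢ) ≤ μ(0 ↔ Σ_{i∈s} vᵢ)`.
[cite: Grimmett2006, Thm. (5.44) (proof; supermultiplicativity)] -/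
theorem prod_real_openConn_le_real_openConn_sum [IsProbabilityMeasure μ] (hFKG : IsPositivelyAssociated μ)
    (hT : ∀ v : Site d, MeasurePreserving (BondConfig.relabel (sym2Equiv (Site.shift v))) μ μ)
    {ι : Type*} (s : Finset ι) (v : ι → Site d) :
    ∏ i ∈ s, μ.real (openConn (0 : Site d) (v i)) ≤ μ.real (openConn (0 : Site d) (∑ i ∈ s, v i)) := by
  classical
  induction s using Finset.induction_on with
  | empty =>
    have h0 : (openConn (0 : Site d) (0 : Site d) : Set (BondConfig (Site d))) = univ :=
      eq_univ_of_forall fun _ => SimpleGraph.Reachable.refl _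
    simp [h0]
  | insert a s ha ih =>
    rw [Finset.prod_insert ha, Finset.sum_insert ha]
    calc μ.real (openConn (0 : Site d) (v a)) * ∏ i ∈ s, μ.real (openConn (0 : Site d) (v i))
        ≤ μ.real (openConn (0 : Site d) (v a)) * μ.real (openConn (0 : Site d) (∑ i ∈ s, v i)) :=
          mul_le_mul_of_nonneg_left ih measureReal_nonneg
      _ ≤ μ.real (openConn (0 : Site d) (v a + ∑ i ∈ s, v i)) :=
          real_openConn_mul_le_real_openConn_add_of_measurePreserving hFKG hT _ _

/-- **Upper norm bound `ψ(u) ≤ ‖u‖₁ ψ`**: if `-n⁻¹ log μ(0 ↔ n e_k) → ψ` (the axis rate) and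
`-n⁻¹ log μ(0 ↔ nu) → ψ_u`, then `ψ_u ≤ (Σᵢ |uᵢ|) ψ` — supermultiplicativity along the coordinate path from `0` to
`nu` and axis symmetry. [cite: Grimmett2006, Thm. (5.44) (proof; supermultiplicativity)] -/
theorem le_l1Norm_mul_of_tendsto [IsProbabilityMeasure μ] (hFKG : IsPositivelyAssociated μ)
    (hT : ∀ v : Site d, MeasurePreserving (BondConfig.relabel (sym2Equiv (Site.shift v))) μ μ)
    (hS : ∀ (π : Equiv.Perm (Fin d)) (ε : Fin d → ℤˣ),
      MeasurePreserving (BondConfig.relabel (sym2Equiv (Site.signedPerm π ε))) μ μ)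
    (k : Fin d) (hposk : ∀ n : ℕ, 0 < μ.real (openConn (0 : Site d) (n • (Pi.single k (1 : ℤ) : Site d))))
    {ψ : ℝ}
    (hψ : Tendsto (fun n : ℕ => -Real.log (μ.real (openConn (0 : Site d) (n • (Pi.single k (1 : ℤ) : Site d)))) / n)
      atTop (𝓝 ψ))
    (u : Site d) {ψu : ℝ}
    (hlim : Tendsto (fun n : ℕ => -Real.log (μ.real (openConn (0 : Site d) (n • u))) / n) atTop (𝓝 ψu)) :
    ψu ≤ (∑ i, ((u i).natAbs : ℝ)) * ψ := by
  classical
  -- the axis sequence and its rescaled subsequences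
  set a : ℕ → ℝ := fun n => -Real.log (μ.real (openConn (0 : Site d) (n • (Pi.single k (1 : ℤ) : Site d))))
    with ha
  -- for each coordinate, `a (n |u_i|) / n → |u_i| ψ`
  have hcoord : ∀ i : Fin d, Tendsto (fun n : ℕ => a (n * (u i).natAbs) / n) atTop (𝓝 (((u i).natAbs : ℝ) * ψ)) := by
    intro i
    rcases Nat.eq_zero_or_pos (u i).natAbs with h0 | hpos
    · have h00 : (openConn (0 : Site d) (0 : Site d) : Set (BondConfig (Site d))) = univ :=
        eq_univ_of_forall fun _ => SimpleGraph.Reachable.refl _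
      simp [h0, ha, h00]
    · have h1 : Tendsto (fun n : ℕ => n * (u i).natAbs) atTop atTop :=
        tendsto_id.atTop_mul_const' hpos
      have h2 := hψ.comp h1
      have h3 : Tendsto (fun n : ℕ => a (n * (u i).natAbs) / ((n * (u i).natAbs : ℕ) : ℝ) * ((u i).natAbs : ℝ))
          atTop (𝓝 (ψ * ((u i).natAbs : ℝ))) := h2.mul tendsto_const_nhds
      rw [mul_comm] at h3
      refine h3.congr' ?_
      filter_upwards [eventually_ge_atTop 1] with n hn
      have hn' : (n : ℝ) ≠ 0 := (Nat.cast_pos.2 hn).ne'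
      have hu' : ((u i).natAbs : ℝ) ≠ 0 := (Nat.cast_pos.2 hpos).ne'
      simp only [Nat.cast_mul]
      field_simp
  -- the sum of the coordinate sequences tends to `‖u‖₁ ψ`
  have hsum : Tendsto (fun n : ℕ => ∑ i, a (n * (u i).natAbs) / n) atTop (𝓝 (∑ i, ((u i).natAbs : ℝ) * ψ)) :=
    tendsto_finsetSum _ fun i _ => hcoord i
  rw [← Finset.sum_mul] at hsum
  refine le_of_tendsto_of_tendsto' hlim hsum fun n => ?_
  -- termwise: `-log μ(0 ↔ nu) ≤ Σ_i a(n|u_i|)`, then divide by `n`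
  rw [← Finset.sum_div]
  refine div_le_div_of_nonneg_right ?_ n.cast_nonneg
  have hprod := prod_real_openConn_le_real_openConn_sum hFKG hT (Finset.univ : Finset (Fin d))
    (fun i => ((n : ℤ) * u i) • (Pi.single i (1 : ℤ) : Site d))
  have hsum_eq : ∑ i, ((n : ℤ) * u i) • (Pi.single i (1 : ℤ) : Site d) = n • u := by
    have h := univ_sum_zsmul_single (n • u)
    simpa only [Pi.smul_apply, nsmul_eq_mul] using h
  rw [hsum_eq] at hprod
  have hterm : ∀ i : Fin d, μ.real (openConn (0 : Site d) (((n : ℤ) * u i) • (Pi.single i (1 : ℤ) : Site d))) =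
      μ.real (openConn (0 : Site d) ((n * (u i).natAbs) • (Pi.single k (1 : ℤ) : Site d))) := by
    intro i
    rw [real_openConn_zsmul_single_eq hS k i, Int.natAbs_mul, Int.natAbs_natCast]
  simp_rw [hterm] at hprod
  have hposprod : 0 < ∏ i, μ.real (openConn (0 : Site d) ((n * (u i).natAbs) • (Pi.single k (1 : ℤ) : Site d))) :=
    Finset.prod_pos fun i _ => hposk _
  have hlog := Real.log_le_log hposprod hprod
  rw [Real.log_prod (s := Finset.univ) (fun i _ => (hposk _).ne')] at hlog
  simp only [ha]
  rw [Finset.sum_neg_distrib]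
  linarith [hlog]

end Invariant

/-! ### §3 The random-cluster measures: `‖u‖_∞ ψ ≤ ψ(u) ≤ ‖u‖₁ ψ` -/

section FK

variable {d : ℕ} {b : Bool} {p q : ℝ} {P : Measure (BondConfig (Site d))}

/-- **Norm bounds for the directional rate of `φ^b_{p,q}`** (`d ≥ 1`, `0 < p ≤ 1`, `q ≥ 1`, free or wired): for every
lattice vector `u` the rate `ψ_u = lim -n⁻¹ log φ^b(0 ↔ nu)` of `ConnectivityDecayRate.lean` and the axis / radius rate
`ψ = lim -n⁻¹ log φ^b(0 ↔ ∂Λ_n)` of `RadiusDecayRate.lean` satisfy `‖u‖_∞ ψ ≤ ψ_u ≤ ‖u‖₁ ψ`; in particular the rate is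
positive in one direction iff in all. [cite: Grimmett2006, Thm. (5.44), Cor. (5.45), eq. (5.46)] -/
theorem IsBoxLimit.exists_decayRate_norm_bounds (hP : IsBoxLimit d b p q P) (hp : p ∈ Set.Ioc (0 : ℝ) 1) (hq : 1 ≤ q)
    (k : Fin d) (u : Site d) :
    ∃ ψu ψ : ℝ, 0 ≤ ψ ∧
      Tendsto (fun n : ℕ => -Real.log (P.real (openConn (0 : Site d) (n • u))) / n) atTop (𝓝 ψu) ∧
      Tendsto (fun n : ℕ => -Real.log (P.real (siteToBoundary d n)) / n) atTop (𝓝 ψ) ∧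
      (Finset.univ.sup fun i => (u i).natAbs : ℕ) * ψ ≤ ψu ∧ ψu ≤ (∑ i, ((u i).natAbs : ℝ)) * ψ := by
  haveI := hP.isProbabilityMeasure
  have hd : 0 < d := Fin.pos k
  have hp' : p ∈ Set.Icc (0 : ℝ) 1 := ⟨hp.1.le, hp.2⟩
  have hq0 : 0 < q := one_pos.trans_le hq
  obtain ⟨ψu, -, -, hlimu, -⟩ := hP.exists_decayRate hp hq u
  obtain ⟨ψ, hψ0, hlimA, hlimR, hbdA, -⟩ := hP.exists_radiusDecayRate hp hq k
  refine ⟨ψu, ψ, hψ0, hlimu, hlimR, ?_, ?_⟩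
  · exact supNorm_mul_le_of_tendsto hd (hP.isPositivelyAssociated hp' hq) (hP.measurePreserving_relabel_shift hp' hq)
      (hP.measurePreserving_relabel_signedPerm hp' hq0) k hbdA (fun n => hP.real_openConn_pos hp hq 0 _) hlimu
  · exact le_l1Norm_mul_of_tendsto (hP.isPositivelyAssociated hp' hq) (hP.measurePreserving_relabel_shift hp' hq)
      (hP.measurePreserving_relabel_signedPerm hp' hq0) k (fun n => hP.real_openConn_pos hp hq 0 _) hlimA u hlimu

/-- **Norm bounds for `rcLimit d b p q`** (`d ≥ 1`, `0 < p ≤ 1`, `q ≥ 1`, both `b`): `‖u‖_∞ ψ ≤ ψ_u ≤ ‖u‖₁ ψ`.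
[cite: Grimmett2006, Thm. (5.44), Cor. (5.45), eq. (5.46)] -/
theorem exists_decayRate_rcLimit_norm_bounds (b : Bool) (hp : p ∈ Set.Ioc (0 : ℝ) 1) (hq : 1 ≤ q) (k : Fin d)
    (u : Site d) :
    ∃ ψu ψ : ℝ, 0 ≤ ψ ∧
      Tendsto (fun n : ℕ => -Real.log ((rcLimit d b p q).real (openConn (0 : Site d) (n • u))) / n) atTop (𝓝 ψu) ∧
      Tendsto (fun n : ℕ => -Real.log ((rcLimit d b p q).real (siteToBoundary d n)) / n) atTop (𝓝 ψ) ∧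
      (Finset.univ.sup fun i => (u i).natAbs : ℕ) * ψ ≤ ψu ∧ ψu ≤ (∑ i, ((u i).natAbs : ℝ)) * ψ :=
  (isBoxLimit_rcLimit b ⟨hp.1.le, hp.2⟩ hq).exists_decayRate_norm_bounds hp hq k u

end FK

end Summit.CriticalPhenomena.PercolationContinuityZ3.Theorems.FK

end
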